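import Literature.NumberTheory.Sieve.LargestPrimeFactorCubicSieveMain
import Literature.NumberTheory.Sieve.LargestPrimeFactorCubicKProduct
import Literature.NumberTheory.Sieve.LargestPrimeFactorCubicMertensG
import HarnessLib

/-!
# Heath-Brown 2001 (PLMS), §6 p. 23: `∏_{p<X^δ}(1 − g_q(p)/p) = 2 ∏_{p<X^δ}(1 − g(p)/p) ∏_{p∣q, p<X^δ}(1 − g(p)/p)⁻¹`
# and the removal of the large prime factors of `q`

Topic `Literature/NumberTheory/Sieve`; a PROVED layer (no named facts) under the named fact
`Irving2015_largestPrimeFactor_cubic` (`LargestPrimeFactorCubic.lean`), joining the sifting product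
`BetaSieve.vprod (gDens M)` of `…SieveMain` with the Mertens product `gProd` of `…MertensG`.  Source:
D. R. Heath-Brown, *The largest prime factor of `X³ + 2`*, Proc. London Math. Soc. (3) 82 (2001) 554–596,
§6 pp. 22–23: `σ₂(q) ≥ {C₀ + o(1)} ∏_{p<X^δ}(1 − g_q(p)/p)`, "`∏_{p<X^δ}(1 − g_q(p)/p) = 2∏_{p<X^δ}(1 −
g(p)/p) ∏_{p∣q}(1 − g(p)/p)⁻¹`, on noting that any prime factor `p` of `q` for which `p ≥ X^δ` can have
only a negligible effect", whence `f(q)σ₂(q) ≥ 2{C₀ + o(1)} h(q) ∏_{p<X^δ}(1 − g(p)/p)`,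
`h(q) = f(q)∏_{p∣q}(1 − g(p)/p)⁻¹`.

PROVED here, for `q` coprime to `6` and `z > 2`:

* `vprod_gDens_two_mul_eq` — `V(gDens (2q); P(z)) = 2 · gProd z · ∏_{p∣q, p<z}(1 − g(p)/p)⁻¹`
  (exact; the factor `2` is `(1 − g(2)/2)⁻¹`, `g(2) = 1`);
* `prod_large_primeFactors_ge` — "negligible effect": `∏_{p∣q, p≥z}(1 − g(p)/p) ≥ 1 − 3 ω(q)/z`;
* **`fq_mul_vprod_ge`** — `f(q) V(gDens(2q); P(z)) ≥ 2 gProd z · (f(q)∏_{p∣q}(1 − g(p)/p)⁻¹) · (1 − 3ω(q)/z)`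
  (the last bracket is `h(q)` by `…HFun.hFun_eq_of_mem_Q`).

## References

* D. R. Heath-Brown, *The largest prime factor of `X³ + 2`*, Proc. London Math. Soc. (3) 82 (2001)
  554–596, §6 pp. 22–23. [`HeathBrown2001LargestPrimeFactorCubic`]

## Mathlib / tree search

Tree: `gDens`, `gDensAt`, `gDens_apply_prime` (`…SieveMain`), `BetaSieve.vprod`, `primesProdBelow`,
`primeFactors_primesProdBelow` (`SieveFramework…`), `gProd`, `gFactor` (`…MertensG`), `fq` — NOT imported
(kept as the explicit product `∏_{p∣q}(1 − 2/p)`), `one_sub_sum_le_prod_one_sub` (`…KProduct`), `gFactor_pos` (`…MertensG`),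
`CubicPrimes.cubeRootTwoCount_two`, `cubeRootTwoCount_le_three`.  Mathlib: `Finset.prod_filter_mul_prod_filter_not`,
`Finset.prod_inv_distrib`.
-/

noncomputable section

open Finset Real

namespace Literature.NumberTheory.Sieve.HeathBrown2001

open BetaSieve CubicPrimes

/-- **`V(gDens(2q); P(z)) = 2 gProd(z) ∏_{p∣q, p<z}(1 − g(p)/p)⁻¹`** for `q` coprime to `6` and `z > 2`.
[cite: HeathBrown2001LargestPrimeFactorCubic, §6 p. 23] -/
theorem vprod_gDens_two_mul_eq {q : ℕ} (hq6 : q.Coprime 6) {z : ℝ} (hz : 2 < z) :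
    vprod (gDens (2 * q)) (primesProdBelow z) =
      2 * gProd z * (∏ p ∈ (Nat.primesBelow ⌈z⌉₊).filter (fun p => p ∣ q), gFactor p)⁻¹ := by
  classical
  have hq0 : q ≠ 0 := fun h => by rw [h] at hq6; norm_num at hq6
  have h2q : ¬ (2 ∣ q) := fun h => by
    have : 2 ∣ Nat.gcd q 6 := Nat.dvd_gcd h (by norm_num)
    rw [hq6] at this; omega
  rw [vprod, primeFactors_primesProdBelow, gProd]
  -- split the full product at the primes dividing `2q`
  set S := Nat.primesBelow ⌈z⌉₊ with hS
  have hsplit := prod_filter_mul_prod_filter_not S (fun p => p ∣ 2 * q) (fun p => gFactor p)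
  -- the factors with `p ∣ 2q` in `vprod` are `1`; the others are `gFactor p`
  have hV : ∏ p ∈ S, (1 - gDens (2 * q) p) = ∏ p ∈ S.filter (fun p => ¬ p ∣ 2 * q), gFactor p := by
    rw [← prod_filter_mul_prod_filter_not S (fun p => p ∣ 2 * q)]
    have h1 : ∏ p ∈ S.filter (fun p => p ∣ 2 * q), (1 - gDens (2 * q) p) = 1 := by
      refine prod_eq_one fun p hp => ?_
      rw [mem_filter] at hp
      rw [gDens_apply_prime _ (Nat.prime_of_mem_primesBelow hp.1), gDensAt, if_pos hp.2, sub_zero]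
    rw [h1, one_mul]
    refine prod_congr rfl fun p hp => ?_
    rw [mem_filter] at hp
    rw [gDens_apply_prime _ (Nat.prime_of_mem_primesBelow hp.1), gDensAt, if_neg hp.2, gFactor]
  rw [hV]
  -- the `p ∣ 2q` part of `gProd` is `gFactor 2 · ∏_{p ∣ q} gFactor p = (1/2) ∏_{p∣q}`
  have h2mem : 2 ∈ S := by
    rw [hS, Nat.mem_primesBelow]
    exact ⟨(Nat.lt_ceil.mpr (by exact_mod_cast hz)), Nat.prime_two⟩
  have hdvd_split : S.filter (fun p => p ∣ 2 * q) = insert 2 (S.filter (fun p => p ∣ q)) := by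
    ext p
    rw [mem_filter, mem_insert, mem_filter]
    constructor
    · rintro ⟨hpS, hp2q⟩
      have hpP := Nat.prime_of_mem_primesBelow hpS
      rcases (Nat.Prime.dvd_mul hpP).mp hp2q with h2 | hq'
      · left; exact (Nat.prime_dvd_prime_iff_eq hpP Nat.prime_two).mp h2
      · right; exact ⟨hpS, hq'⟩
    · rintro (rfl | ⟨hpS, hpq⟩)
      · exact ⟨h2mem, dvd_mul_right 2 q⟩
      · exact ⟨hpS, hpq.mul_left 2⟩
  have h2not : (2 : ℕ) ∉ S.filter (fun p => p ∣ q) := by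
    rw [mem_filter]; exact fun h => h2q h.2
  have hg2 : gFactor 2 = 1 / 2 := by rw [gFactor, cubeRootTwoCount_two]; norm_num
  have hprodpos : 0 < ∏ p ∈ S.filter (fun p => p ∣ q), gFactor p :=
    prod_pos fun p hp => gFactor_pos (Nat.prime_of_mem_primesBelow (mem_filter.mp hp).1)
  rw [← hsplit, hdvd_split, prod_insert h2not, hg2]
  field_simp

/-- **The large prime factors of `q` have a negligible effect**:
`∏_{p∣q, p ∉ primesBelow ⌈z⌉} (1 − g(p)/p) ≥ 1 − 3 ω(q)/z` (`z > 0`). [cite: HeathBrown2001LargestPrimeFactorCubic, §6 p. 23] -/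
theorem prod_large_primeFactors_ge {q : ℕ} {z : ℝ} (hz : 0 < z) :
    1 - 3 * (q.primeFactors.card : ℝ) / z ≤
      ∏ p ∈ q.primeFactors.filter (fun p => p ∉ Nat.primesBelow ⌈z⌉₊), gFactor p := by
  classical
  set T := q.primeFactors.filter (fun p => p ∉ Nat.primesBelow ⌈z⌉₊) with hT
  have hmem : ∀ p ∈ T, p.Prime ∧ z ≤ p := by
    intro p hp
    rw [hT, mem_filter, Nat.mem_primesBelow, not_and'] at hp
    have hpP := Nat.prime_of_mem_primeFactors hp.1
    refine ⟨hpP, ?_⟩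
    have := hp.2 hpP
    rw [not_lt] at this
    exact (Nat.ceil_le).mp this |> fun h => by exact_mod_cast (Nat.le_ceil z).trans (by exact_mod_cast this)
  -- Weierstrass: `∏ (1 − a_p) ≥ 1 − ∑ a_p` with `a_p = g(p)/p ≤ 3/z`
  have hW := one_sub_sum_le_prod_one_sub T (fun p => (cubeRootTwoCount p : ℝ) / p)
    (fun p hp => by have := (hmem p hp).1.pos; positivity)
    (fun p hp => by
      have h := gFactor_pos (hmem p hp).1
      rw [gFactor] at h; linarith)
  have hsum : ∑ p ∈ T, (cubeRootTwoCount p : ℝ) / p ≤ 3 * (q.primeFactors.card : ℝ) / z := by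
    calc ∑ p ∈ T, (cubeRootTwoCount p : ℝ) / p ≤ ∑ _p ∈ T, (3 : ℝ) / z := by
          refine sum_le_sum fun p hp => ?_
          obtain ⟨hpP, hzp⟩ := hmem p hp
          have h3 : (cubeRootTwoCount p : ℝ) ≤ 3 := by exact_mod_cast cubeRootTwoCount_le_three hpP
          have hp0 : (0 : ℝ) < p := by exact_mod_cast hpP.pos
          rw [div_le_div_iff₀ hp0 hz]
          nlinarith
      _ = #T * (3 / z) := by rw [sum_const, nsmul_eq_mul]
      _ ≤ q.primeFactors.card * (3 / z) := by
          gcongr; exact filter_subset _ _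
      _ = 3 * (q.primeFactors.card : ℝ) / z := by ring
  calc 1 - 3 * (q.primeFactors.card : ℝ) / z ≤ 1 - ∑ p ∈ T, (cubeRootTwoCount p : ℝ) / p := by linarith
    _ ≤ ∏ p ∈ T, (1 - (cubeRootTwoCount p : ℝ) / p) := hW
    _ = ∏ p ∈ T, gFactor p := prod_congr rfl fun p _ => by rw [gFactor]

/-- **`f(q) V(gDens(2q); P(z)) ≥ 2 gProd(z) · [f(q)∏_{p∣q}(1 − g(p)/p)⁻¹] · (1 − 3ω(q)/z)`** for `q` coprime
to `6`, `z > 2` (the bracket is `h(q)`). [cite: HeathBrown2001LargestPrimeFactorCubic, §6 p. 23] -/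
theorem fq_mul_vprod_ge {q : ℕ} (hq6 : q.Coprime 6) {z : ℝ} (hz : 2 < z) :
    2 * gProd z * ((∏ p ∈ q.primeFactors, (1 - 2 / (p : ℝ))) * ∏ p ∈ q.primeFactors, (gFactor p)⁻¹) *
        (1 - 3 * (q.primeFactors.card : ℝ) / z) ≤
      (∏ p ∈ q.primeFactors, (1 - 2 / (p : ℝ))) * vprod (gDens (2 * q)) (primesProdBelow z) := by
  classical
  have hq0 : q ≠ 0 := fun h => by rw [h] at hq6; norm_num at hq6
  rw [vprod_gDens_two_mul_eq hq6 hz]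
  -- split `∏_{p∣q} gFactor⁻¹` into `p < z` and `p ≥ z`
  set S := Nat.primesBelow ⌈z⌉₊ with hS
  have hsplit := prod_filter_mul_prod_filter_not q.primeFactors (fun p => p ∈ S) (fun p => (gFactor p)⁻¹)
  have hsmall : q.primeFactors.filter (fun p => p ∈ S) = S.filter (fun p => p ∣ q) := by
    ext p
    rw [mem_filter, mem_filter, Nat.mem_primeFactors]
    constructor
    · rintro ⟨⟨hp, hpq, -⟩, hpS⟩; exact ⟨hpS, hpq⟩
    · rintro ⟨hpS, hpq⟩; exact ⟨⟨Nat.prime_of_mem_primesBelow hpS, hpq, hq0⟩, hpS⟩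
  have hgpos : 0 < gProd z := by
    rw [gProd]; exact prod_pos fun p hp => gFactor_pos (Nat.prime_of_mem_primesBelow hp)
  have hfpos : 0 < ∏ p ∈ q.primeFactors, (1 - 2 / (p : ℝ)) := by
    refine prod_pos fun p hp => ?_
    have hpP := Nat.prime_of_mem_primeFactors hp
    have hpq := Nat.dvd_of_mem_primeFactors hp
    have h5 : (5 : ℝ) ≤ p := by
      have h2 : p ≠ 2 := fun h => by
        have : 2 ∣ Nat.gcd q 6 := Nat.dvd_gcd (h ▸ hpq) (by norm_num); rw [hq6] at this; omega
      have h3 : p ≠ 3 := fun h => by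
        have : 3 ∣ Nat.gcd q 6 := Nat.dvd_gcd (h ▸ hpq) (by norm_num); rw [hq6] at this; omega
      have := hpP.two_le
      have h5' : 5 ≤ p := by
        by_contra hlt; interval_cases p <;> first | omega | exact absurd hpP (by decide)
      exact_mod_cast h5'
    rw [sub_pos, div_lt_one (by linarith)]; linarith
  have hlarge_pos : 0 < ∏ p ∈ q.primeFactors.filter (fun p => p ∉ S), (gFactor p)⁻¹ :=
    prod_pos fun p hp => inv_pos.mpr (gFactor_pos (Nat.prime_of_mem_primeFactors (mem_filter.mp hp).1))
  have hlarge_le : (∏ p ∈ q.primeFactors.filter (fun p => p ∉ S), (gFactor p)⁻¹) *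
      (1 - 3 * (q.primeFactors.card : ℝ) / z) ≤ 1 := by
    have h1 := prod_large_primeFactors_ge (q := q) (by linarith : 0 < z)
    rw [← hS] at h1
    have h2 : (∏ p ∈ q.primeFactors.filter (fun p => p ∉ S), (gFactor p)⁻¹) *
        ∏ p ∈ q.primeFactors.filter (fun p => p ∉ S), gFactor p = 1 := by
      rw [← prod_mul_distrib]
      exact prod_eq_one fun p hp => inv_mul_cancel₀ (gFactor_pos (Nat.prime_of_mem_primeFactors (mem_filter.mp hp).1)).ne'
    calc (∏ p ∈ q.primeFactors.filter (fun p => p ∉ S), (gFactor p)⁻¹) * (1 - 3 * (q.primeFactors.card : ℝ) / z)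
        ≤ (∏ p ∈ q.primeFactors.filter (fun p => p ∉ S), (gFactor p)⁻¹) *
            ∏ p ∈ q.primeFactors.filter (fun p => p ∉ S), gFactor p :=
          mul_le_mul_of_nonneg_left h1 hlarge_pos.le
      _ = 1 := h2
  -- assemble
  rw [← hsplit, hsmall, prod_inv_distrib]
  set Psmall := (∏ p ∈ S.filter (fun p => p ∣ q), gFactor p)⁻¹ with hPs
  set Plarge := ∏ p ∈ q.primeFactors.filter (fun p => p ∉ S), (gFactor p)⁻¹ with hPl
  set F := ∏ p ∈ q.primeFactors, (1 - 2 / (p : ℝ)) with hF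
  have hPs0 : 0 < Psmall := by
    rw [hPs]; exact inv_pos.mpr (prod_pos fun p hp => gFactor_pos (Nat.prime_of_mem_primesBelow (mem_filter.mp hp).1))
  have key : 0 ≤ 2 * gProd z * (F * Psmall) := by positivity
  calc 2 * gProd z * (F * (Psmall * Plarge)) * (1 - 3 * (q.primeFactors.card : ℝ) / z)
      = 2 * gProd z * (F * Psmall) * (Plarge * (1 - 3 * (q.primeFactors.card : ℝ) / z)) := by ring
    _ ≤ 2 * gProd z * (F * Psmall) * 1 := mul_le_mul_of_nonneg_left hlarge_le key
    _ = F * (2 * gProd z * Psmall) := by ring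

end Literature.NumberTheory.Sieve.HeathBrown2001
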